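import Summits.QuantumFields.BalabanUV.T4Continuum.Support.B13TermParamGaussianBiProd
import Mathlib.MeasureTheory.Integral.Pi
import Mathlib.LinearAlgebra.StdBasis

/-!
# B13TermParamGaussianBiPi — row O1-d2-ii «act instance» of the NE5 crux O1, part 6: THE FINITE PRODUCT OF (2.14)-CORES over a
# finite family of FACTORS is a core, and its term is the PRODUCT of the factors' terms — the n-ary form of part 4's binary product,
# on the `L²`-product `PiLp 2 V` of the factors' fluctuation spaces; with the general measure-theoretic lemma it needs and Mathlib lacks:
# `ofLp : PiLp 2 E → Π i, E i` is measure preserving from `volume` to `Measure.pi volume` for finite-dimensional inner-product factors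
# (cell `pub-balaban`, T⁴ fan-out, `HOME/t4/b2b-balaban-t4-ne5-p1/O1-CLAIM-TABLE-NE5-P1.md` row O1-d2-ii; design v0.5 R18)

Unit `b2b-balaban-t4-ne5-formalise-leaf-08` (NE5 formalisation swarm, leaf prover 08, gen 3).  Summits-side NEW WORK under the LEAN
PLACEMENT RULE (cell modelling + bookkeeping; nothing of the manuscripts under audit is asserted; 0 cite tags).  HONEST FRAMING: rung
(B)+1 of the FINITE-VOLUME T⁴ continuum programme — NOT infinite volume, NOT a mass gap, NOT the Clay problem, NOT a proof of NE5
(`T4OutputRate.NE5` is NOT PRINTED and NOT PROVED; spine 0/9, unchanged).  HONEST DEPENDENCY (cell line, verbatim): continuum YM on T⁴ ⇐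
BetaPertH ∧ nine spine estimates (0/9 proved); BetaPertH ⇐ (D1) ∧ (D4) ∧ CAP+tail; G-an2-4 gates asym, D1 and NE2/3/4.

WHAT THIS MODULE IS.  A B13 tree-graph term is `ρᵀ(i)·coeff(i)·Π_{m ≤ len i} act(Z_m, j_m)` (`B13StepTermFamily.term`), each factor
activity one resummed (2.14)-integral = `termAt` of one core (parts 2∕4∕5).  The owner's shape `TermGaussianParamBi` is TERM-level, so the
instancer needs the product of the `len i + 1` factor cores as ONE core indexed by the term — over a FINITE TYPE of factors, in a type
family depending on the term index only.  This file gives exactly that: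
* §0 (general, Mathlib-level) `parallelepiped_piBasis`, `addHaar_piBasis` (`(Pi.basis b).addHaar = Measure.pi (fun i => (b i).addHaar)`),
  **`volume_preserving_ofLp_pi`** (`MeasurePreserving ofLp (volume : Measure (PiLp 2 E)) (Measure.pi fun _ => volume)` for
  finite-dimensional real inner-product factors — Mathlib has the cases `ι → ℝ` (`PiLp.volume_preserving_ofLp`) and the binary
  `WithLp 2 (U × V)` only) and the Fubini corollary **`integral_piLp_prod_eq_prod`** (`∫ Π_i f_i(v_i) dv = Π_i ∫ f_i`).
* §1 `BiCore.pi 𝔠 : BiCore P (fun Y : Σ m, 𝒴 m => dom Y.1 Y.2) Op (Π m, PΛ m) (PiLp 2 V)` for `𝔠 m : BiCore P (dom m) Op (PΛ m) (V m)`,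
  `m : M` finite: parameter measure `Measure.pi lam` (finite), weight `Π_m w_m(p_m)` (bound `Π wB_m`), normalisation `Π N_m`, exponent
  `Σ_m q_m(o, p_m, v_m)` (block-diagonal), constraints concatenated (each read through the coordinate projection `PiLp.proj`), signs
  added, polymer families `Σ_m D_m`, contour weights∕radii∕field maps fibrewise.
* §2 `mem_chiSet_pi`, `chi_pi` (`chi = ⊗_m chi_m`), `readOut_pi_apply` (`Λ = ⊕_m Λ_m`), `N₁_pi` (`N₁ = Σ_m N₁,m`), `wB_pi`.
* §3 **`termAt_pi : (BiCore.pi 𝔠).termAt o h = Π_m (𝔠 m).termAt o h`** (unconditional: `integral_fintype_prod_eq_prod` for the contour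
  parameters, §0 for the fluctuation fields).
Part 7 (`B13TermCoreFamily`) puts `𝟙[Rel]·coeff • BiCore.pi (factor cores of i)` into `B13StepTermFamily.term` and reads off the shape.

STATUS (census, Edison rule).  Dictionary∕bookkeeping + one general measure-theory lemma; no estimate of [II] is proved or asserted; the
operator letters of the product are the factors' combined by the instancer.  NE5 NOT PROVED; 0/12 leaves on Bałaban's concrete objects;
spine 0/9; rung (B)+1 finite T⁴; NOT infinite volume ∕ mass gap ∕ Clay.  0 sorry; axioms ⊆ {propext, Classical.choice, Quot.sound}.
-/

noncomputable section

open scoped BigOperators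
open Set MeasureTheory Finset WithLp

/-! ## §0 Volume on an `L²`-product of finite-dimensional inner-product spaces is the product of the volumes -/

namespace Summit.QuantumFields.BalabanUV.T4Continuum.B13TermParamGaussianBiPi

/-- [folklore] The parallelepiped of the product basis `Pi.basis b` is the product of the factors' parallelepipeds (`Pi.basis_repr`). -/
theorem parallelepiped_piBasis {η : Type*} [Fintype η] {ι : η → Type*} [∀ i, Fintype (ι i)] {E : η → Type*}
    [∀ i, AddCommGroup (E i)] [∀ i, Module ℝ (E i)] (b : ∀ i, Module.Basis (ι i) ℝ (E i)) :
    parallelepiped (Pi.basis b) = Set.pi Set.univ fun i => parallelepiped (b i) := by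
  ext x
  simp only [parallelepiped_basis_eq, Pi.basis_repr, Set.mem_setOf_eq, Set.mem_univ_pi, Sigma.forall]

/-- [folklore] The Haar measure of the product basis is the product measure of the factors' Haar measures (`Basis.addHaar_eq_iff`: the
product measure is additive-left-invariant, σ-finite, and gives the product parallelepiped mass `Π_i 1 = 1`). -/
theorem addHaar_piBasis {η : Type*} [Fintype η] {ι : η → Type*} [∀ i, Fintype (ι i)] {E : η → Type*}
    [∀ i, NormedAddCommGroup (E i)] [∀ i, NormedSpace ℝ (E i)] [∀ i, MeasurableSpace (E i)] [∀ i, BorelSpace (E i)]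
    [∀ i, FiniteDimensional ℝ (E i)] (b : ∀ i, Module.Basis (ι i) ℝ (E i)) :
    (Pi.basis b).addHaar = Measure.pi fun i => (b i).addHaar := by
  rw [Module.Basis.addHaar_eq_iff, Module.Basis.coe_parallelepiped, parallelepiped_piBasis, Measure.pi_pi]
  exact Finset.prod_eq_one fun i _ => Module.Basis.addHaar_self (b i)

/-- [folklore] **VOLUME ON `PiLp 2 E` IS THE PRODUCT VOLUME**: for finitely many finite-dimensional real inner-product spaces `E i`
(each with its canonical `volume`), `ofLp : PiLp 2 E → Π i, E i` is measure preserving from `volume` (the canonical volume of the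
inner-product space `PiLp 2 E`) to `Measure.pi (fun i => volume)`.  Proof: `volume = (Pi.orthonormalBasis B).toBasis.addHaar`
(`OrthonormalBasis.addHaar_eq_volume`) `= ((Pi.basis B).map toLp).addHaar = map toLp (Pi.basis B).addHaar` (`Basis.map_addHaar`)
`= map toLp (Measure.pi addHaar)` (`addHaar_piBasis`), and `addHaar (B i) = volume` again.  (Mathlib: `PiLp.volume_preserving_ofLp` is the
case `E i = ℝ`; `WithLp.volume_preserving_ofLp` the binary case.) -/
theorem volume_preserving_ofLp_pi {η : Type*} [Fintype η] (E : η → Type*)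
    [∀ i, NormedAddCommGroup (E i)] [∀ i, InnerProductSpace ℝ (E i)] [∀ i, FiniteDimensional ℝ (E i)]
    [∀ i, MeasurableSpace (E i)] [∀ i, BorelSpace (E i)] :
    MeasurePreserving (@ofLp 2 (∀ i, E i)) volume (Measure.pi fun _ => volume) := by
  refine ⟨WithLp.measurable_ofLp 2 _, ?_⟩
  set B : ∀ i, OrthonormalBasis (Fin (Module.finrank ℝ (E i))) ℝ (E i) := fun i => stdOrthonormalBasis ℝ (E i)
  have hvol : (volume : Measure (PiLp 2 E)) = (Pi.orthonormalBasis B).toBasis.addHaar :=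
    (OrthonormalBasis.addHaar_eq_volume _).symm
  have hmap : (Pi.orthonormalBasis B).toBasis =
      (Pi.basis fun i => (B i).toBasis).map (PiLp.continuousLinearEquiv 2 ℝ E).symm.toLinearEquiv := by
    rw [Pi.orthonormalBasis.toBasis]; rfl
  rw [hvol, hmap, ← Module.Basis.map_addHaar, addHaar_piBasis, Measure.map_map (WithLp.measurable_ofLp 2 _)
    (PiLp.continuousLinearEquiv 2 ℝ E).symm.continuous.measurable]
  have hid : (@ofLp 2 (∀ i, E i)) ∘ ⇑(PiLp.continuousLinearEquiv 2 ℝ E).symm = id := by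
    funext x; rfl
  rw [hid, Measure.map_id]
  exact congrArg Measure.pi (funext fun i => OrthonormalBasis.addHaar_eq_volume (B i))

/-- [folklore] **FUBINI ON `PiLp 2 E`**: the integral of a product of functions of the single coordinates is the product of the
integrals (`volume_preserving_ofLp_pi` + Mathlib's `integral_fintype_prod_eq_prod`). -/
theorem integral_piLp_prod_eq_prod {η : Type*} [Fintype η] (E : η → Type*)
    [∀ i, NormedAddCommGroup (E i)] [∀ i, InnerProductSpace ℝ (E i)] [∀ i, FiniteDimensional ℝ (E i)]
    [∀ i, MeasurableSpace (E i)] [∀ i, BorelSpace (E i)] (f : ∀ i, E i → ℂ) :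
    ∫ v : PiLp 2 E, ∏ i, f i (v i) = ∏ i, ∫ x, f i x := by
  have hmp : MeasurePreserving (MeasurableEquiv.toLp 2 (∀ i, E i)).symm volume (Measure.pi fun _ => volume) :=
    volume_preserving_ofLp_pi E
  have key := hmp.integral_comp' (fun x : ∀ i, E i => ∏ i, f i (x i))
  rw [MeasureTheory.integral_fintype_prod_eq_prod] at key
  rw [← key]
  rfl

end Summit.QuantumFields.BalabanUV.T4Continuum.B13TermParamGaussianBiPi

namespace Summit.QuantumFields.BalabanUV.T4Continuum.B13TermParamGaussianBi.BiCore

open Literature.MathematicalPhysics.QuantumFieldTheory.Balaban1983to89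
open Literature.MathematicalPhysics.QuantumFieldTheory.Balaban1983to89.T4OutputRate (Carriers)
open Summit.QuantumFields.BalabanUV.T4Continuum.B13HistDatum (level136)
open Summit.QuantumFields.BalabanUV.T4Continuum.B13HistMeasurable (MeasPotFrame B13HistM)
open Summit.QuantumFields.BalabanUV.T4Continuum.B13HistReadout (VppCLMM)
open Summit.QuantumFields.BalabanUV.T4Continuum.B13TermParamGaussianBiPi (integral_piLp_prod_eq_prod)

variable {C : Carriers} {P : MeasPotFrame C} {Op : Type*} {M : Type*} [Fintype M] {𝒴 : M → Type*} {dom : ∀ m, 𝒴 m → C.Dom}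
  {PΛ : M → Type*} {V : M → Type*} [∀ m, MeasurableSpace (PΛ m)] [∀ m, NormedAddCommGroup (V m)]
  [∀ m, InnerProductSpace ℝ (V m)] [∀ m, MeasurableSpace (V m)]

/-! ## §1 The finite product of cores -/

section Defs

/-- **THE PRODUCT OF A FINITE FAMILY OF (2.14)-CORES** (one per factor `m : M` of a B13 term): independent contour parameters
(`Measure.pi`), independent fluctuation fields in the `L²`-product `PiLp 2 V`, weights and normalisations multiplied, exponents added,
constraints concatenated, polymer families summed (`Σ m, 𝒴 m`), read-outs juxtaposed. [folklore] -/
def pi (𝔠 : ∀ m, BiCore P (dom m) Op (PΛ m) (V m)) :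
    BiCore P (fun Y : (Σ m, 𝒴 m) => dom Y.1 Y.2) Op (∀ m, PΛ m) (PiLp 2 V) where
  lam := Measure.pi fun m => (𝔠 m).lam
  finite := by haveI := fun m => (𝔠 m).finite; infer_instance
  w p := ∏ m, (𝔠 m).w (p m)
  measW := Finset.measurable_prod _ fun m _ => (𝔠 m).measW.comp (measurable_pi_apply m)
  wB := ∏ m, (𝔠 m).wB
  norm_w_le p := by
    rw [norm_prod]
    exact Finset.prod_le_prod (fun m _ => norm_nonneg _) fun m _ => (𝔠 m).norm_w_le (p m)
  N o p := ∏ m, (𝔠 m).N o (p m)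
  q o p v := ∑ m, (𝔠 m).q o (p m) (v m)
  cons := (Finset.univ : Finset M).toList.flatMap fun m =>
    (𝔠 m).cons.map fun c => (c.1.comp (PiLp.proj 2 (𝕜 := ℝ) V m), c.2)
  nsign := ∑ m, (𝔠 m).nsign
  D := Finset.univ.sigma fun m => (𝔠 m).D
  τ p Y := (𝔠 Y.1).τ (p Y.1) Y.2
  measτ Y := ((𝔠 Y.1).measτ Y.2).comp (measurable_pi_apply Y.1)
  rad Y := (𝔠 Y.1).rad Y.2
  rad_nonneg Y := (𝔠 Y.1).rad_nonneg Y.2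
  norm_τ_le p Y := (𝔠 Y.1).norm_τ_le (p Y.1) Y.2
  B Y v := (𝔠 Y.1).B Y.2 (v Y.1)
  measB Y := ((𝔠 Y.1).measB Y.2).comp ((measurable_pi_apply Y.1).comp (WithLp.measurable_ofLp 2 _))

end Defs

/-! ## §2 Factorisation of the potential-free factor, the read-out and the letters -/

section Factor

variable (𝔠 : ∀ m, BiCore P (dom m) Op (PΛ m) (V m))

/-- [folklore] The weight letter of the product is the product of the letters (by construction). -/
theorem wB_pi : (pi 𝔠).wB = ∏ m, (𝔠 m).wB := rfl

/-- [folklore] The product's constraint set is the product of the constraint sets. -/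
theorem mem_chiSet_pi (v : PiLp 2 V) : v ∈ (pi 𝔠).chiSet ↔ ∀ m, v m ∈ (𝔠 m).chiSet := by
  have e : ∀ m (c : (V m →L[ℝ] ℝ) × ℝ × Bool), v ∈ consSet (c.1.comp (PiLp.proj 2 (𝕜 := ℝ) V m), c.2) ↔ v m ∈ consSet c :=
    fun m c => mem_consSet_comp c _ v
  show (∀ c ∈ (Finset.univ : Finset M).toList.flatMap (fun m =>
      (𝔠 m).cons.map fun c => (c.1.comp (PiLp.proj 2 (𝕜 := ℝ) V m), c.2)), v ∈ consSet c) ↔ ∀ m, ∀ c ∈ (𝔠 m).cons, v m ∈ consSet c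
  simp only [List.mem_flatMap, Finset.mem_toList, Finset.mem_univ, true_and, List.mem_map, forall_exists_index, and_imp]
  constructor
  · intro h m c hc
    exact (e m c).1 (h _ m c hc rfl)
  · rintro h _ m c hc rfl
    exact (e m c).2 (h m c hc)

/-- [folklore] **`chi = ⊗_m chi_m`**: the product's potential-free factor factorises. -/
theorem chi_pi (v : PiLp 2 V) : (pi 𝔠).chi v = ∏ m, (𝔠 m).chi (v m) := by
  have hs : (pi 𝔠).nsign = ∑ m, (𝔠 m).nsign := rfl
  unfold chi
  rw [hs]
  by_cases h : ∀ m, v m ∈ (𝔠 m).chiSet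
  · rw [Set.indicator_of_mem ((mem_chiSet_pi 𝔠 v).2 h), ← Finset.prod_pow_eq_pow_sum]
    exact Finset.prod_congr rfl fun m _ => (Set.indicator_of_mem (h m) fun _ => (-1 : ℂ) ^ (𝔠 m).nsign).symm
  · rw [Set.indicator_of_notMem (fun h' => h ((mem_chiSet_pi 𝔠 v).1 h'))]
    obtain ⟨m, hm⟩ := not_forall.1 h
    exact (Finset.prod_eq_zero (Finset.mem_univ m) (Set.indicator_of_notMem hm _)).symm

/-- [folklore] **`Λ = ⊕_m Λ_m`**: the product's history read-out is the sum of the factors' read-outs. -/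
theorem readOut_pi_apply (p : ∀ m, PΛ m) (v : PiLp 2 V) (y : B13HistM P) :
    (pi 𝔠).readOut p v y = ∑ m, (𝔠 m).readOut (p m) (v m) y := by
  simp only [readOut, _root_.sum_apply, _root_.smul_apply, smul_eq_mul]
  show ∑ Y ∈ Finset.univ.sigma (fun m => (𝔠 m).D), _ = _
  rw [Finset.sum_sigma]
  rfl

/-- [folklore] `N₁ = Σ_m N₁(𝔠 m)`: the read-out letter of the product. -/
theorem N₁_pi : (pi 𝔠).N₁ = ∑ m, (𝔠 m).N₁ := by
  unfold N₁
  show ∑ Y ∈ Finset.univ.sigma (fun m => (𝔠 m).D), _ = _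
  rw [Finset.sum_sigma]
  rfl

end Factor

/-! ## §3 The product formula for the term -/

section Term

variable [∀ m, BorelSpace (V m)] [∀ m, FiniteDimensional ℝ (V m)] (𝔠 : ∀ m, BiCore P (dom m) Op (PΛ m) (V m))

/-- [folklore] **THE PRODUCT FORMULA (n-ary)**: the term of the product core is the product of the factors' terms — `Π_m` of
parametrised Gaussian integrals over independent variables is ONE parametrised Gaussian integral (Mathlib's `integral_fintype_prod_eq_prod`
for the contour parameters; §0's `integral_piLp_prod_eq_prod` for the fluctuation fields).  Unconditional. -/
theorem termAt_pi (o : Op) (h : B13HistM P) : (pi 𝔠).termAt o h = ∏ m, (𝔠 m).termAt o h := by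
  haveI := fun m => (𝔠 m).finite
  -- the inner (fluctuation-field) integral factorises
  set g : ∀ m, PΛ m → V m → ℂ := fun m pm vm =>
    (𝔠 m).chi vm * Complex.exp ((𝔠 m).readOut pm vm h) * Complex.exp (-(𝔠 m).q o pm vm) with hg
  have hinner : ∀ p : ∀ m, PΛ m,
      (∫ v, (pi 𝔠).chi v * Complex.exp ((pi 𝔠).readOut p v h) * Complex.exp (-(pi 𝔠).q o p v) ∂volume) =
        ∏ m, ∫ vm, g m (p m) vm ∂volume := by
    intro p
    have hG : (fun v : PiLp 2 V => (pi 𝔠).chi v * Complex.exp ((pi 𝔠).readOut p v h) * Complex.exp (-(pi 𝔠).q o p v)) =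
        fun v => ∏ m, g m (p m) (v m) := by
      funext v
      have hq : (pi 𝔠).q o p v = ∑ m, (𝔠 m).q o (p m) (v m) := rfl
      rw [chi_pi, readOut_pi_apply, Complex.exp_sum, hq, ← Finset.sum_neg_distrib, Complex.exp_sum, ← Finset.prod_mul_distrib,
        ← Finset.prod_mul_distrib]
    rw [hG]
    exact integral_piLp_prod_eq_prod V fun m => g m (p m)
  -- the outer (contour-parameter) integral factorises
  unfold termAt
  simp only [hinner]
  have hlam : (pi 𝔠).lam = Measure.pi fun m => (𝔠 m).lam := rfl
  rw [hlam]
  have hF : (fun p : ∀ m, PΛ m => (pi 𝔠).w p * (pi 𝔠).N o p * ∏ m, ∫ vm, g m (p m) vm ∂volume) =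
      fun p => ∏ m, ((𝔠 m).w (p m) * (𝔠 m).N o (p m) * ∫ vm, g m (p m) vm ∂volume) := by
    funext p
    show (∏ m, (𝔠 m).w (p m)) * (∏ m, (𝔠 m).N o (p m)) * _ = _
    rw [Finset.prod_mul_distrib, Finset.prod_mul_distrib]
  rw [hF, MeasureTheory.integral_fintype_prod_eq_prod
    (fun m pm => (𝔠 m).w pm * (𝔠 m).N o pm * ∫ vm, g m pm vm ∂volume)]

end Term

end Summit.QuantumFields.BalabanUV.T4Continuum.B13TermParamGaussianBi.BiCore

end
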